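import Literature.MathematicalPhysics.QuantumFieldTheory.Balaban1983to89.B8Prop6DentedCubeMemberFlatScalarGammaRec
import Literature.MathematicalPhysics.QuantumFieldTheory.Balaban1983to89.B8Prop6DentedCubeMemberGammaGRec
import Literature.MathematicalPhysics.QuantumFieldTheory.Balaban1983to89.B8SockHFPTraceFreeRec
import Literature.MathematicalPhysics.QuantumFieldTheory.Balaban1983to89.B8Prop5KLevelLettersGRec
import Literature.MathematicalPhysics.QuantumFieldTheory.Balaban1983to89.B8Eq191FlatLettersRDTauRec
import Literature.MathematicalPhysics.QuantumFieldTheory.Balaban1983to89.B8Prop6OfThm4Rec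

/-!
# `Balaban1983to89.B8Prop6DentedCubeMemberFlatScalarGammaGRec` — RECORD TWIN of `B8Prop6CubeMemberFlatScalarGammaG` AT THE DENTED MEMBER ([Balaban1985RegularSpaces]
# PROPOSITION 6 p. 99, EXISTENCE HALF, at the dented record cube member of print's p. 98 sub-lattice, background `1`, from three REAL inequality families and the (1.59)
# clause for `G(1)`, EDITION γ — for `G`-VALUED gauge fields AND gauge transformations; joint J-SU, [Balaban1985Averaging] p. 20 «We consider a Lie subgroup G of a
# unitary group U(N)», print's case of record `G = SU(N)`) FOR THE SYMMETRISED CENTRED block averaging (0.4) of [Balaban1987RG1]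

statement-level skeleton of published theorems with citation tags; proofs where landed; nothing here is a claim about the Yang–Mills mass gap

T. Bałaban, *Spaces of regular gauge field configurations on a lattice and gauge fixing conditions*, Commun. Math. Phys. **99** (1985) 75–102 `[Balaban1985RegularSpaces]`
("[6]"): Prop. 6 (1.135)–(1.138) p. 99, p. 98, Thm 4 p. 88, Prop. 5 (1.106)–(1.110) pp. 93–94, (1.59) p. 86, (1.62) p. 87, (1.31) p. 82, (1.17) p. 78; T. Bałaban, *Averaging
operations for lattice gauge theories*, Commun. Math. Phys. **98** (1985) 17–51 `[Balaban1985Averaging]` ("[3]"): p. 20, (42)–(43) pp. 23–24, Prop. 10 p. 50; T. Bałaban,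
*Propagators for lattice gauge theories in a background field*, Commun. Math. Phys. **99** (1985) 389–434 `[Balaban1985BackgroundPropagators]` ("[4]"): Thms 3.1–3.3
pp. 397–399, (3.23)–(3.25) p. 394; T. Bałaban, *The variational problem and background fields in renormalization group method for lattice gauge theories*, Commun. Math.
Phys. **102** (1985) 277–309 `[Balaban1985Variational]` ("[15]"): (148)–(153) p. 301; T. Bałaban, *Renormalization group approach to lattice gauge field theories. I*, Commun.
Math. Phys. **109** (1987) 249–301 `[Balaban1987RG1]` ("[I]"): (0.3)–(0.4) pp. 252–253.  STATUS: published, refereed.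

CITATION HEADER (lean-in-tree rule).  Cell `pub-ymgap`, «N05-REC» R8 = the `G`∕τ-EDITION OF RECORD (desk `R6-PLAN.md` §6 (B)), file G4 — LEAD PEN dag-n05-e g40.  WHAT IS
REPRODUCED = ★★ `prop6_dentedMember_flat_of_real_γ_mem` — ✓`B8Prop6DentedCubeMemberFlatScalarGammaRec.prop6_dentedMember_flat_of_real_γ` (this seat g39) VERBATIM with the
gauge-group ∕ trace threaded exactly as the engine's `B8Prop6CubeMemberFlatScalarGammaG` threads them through `B8Prop6CubeMemberFlatScalarGamma` (this seat g33): the joint J-SU data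
`(τ, hτ, G, H, hGrp2, hGrp3, hGA : AvgClosedZ d L G, hGH, hGu, hexpG)` are parameters, `U₀ ∈ G`, conclusion `u ∈ G`, `(localGaugeZ …)⁻¹·u ∈ G`.  Inputs BY NAME: (G3)
`B8Prop6DentedCubeMemberGammaGRec.prop6_exists_dentedMember_at_γ₃_mem` (dag-n07-w3), (T4) `B8SockHFPTraceFreeRec.{sockHFP₀_body_of_join_RD_traceFree, sockHFP_body_of_join_59_γ_traceFree}`,
(T6) `B8Prop5KLevelLettersGRec.{hP5base_of_HFP_mem, hP5_of_HFP_mem}`, (T7) `B8Eq191FlatLettersRDTauRec.flatLettersZRD_of_real_tau`, `B8Prop6OfThm4Rec.localGaugeZ_mem`; structure-free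
engine inputs `B8Prop5KLevelLettersG.{mem_of_mgauge_eq, apply_eq_zero_of_cfgExp_mem_of_le_twelfth}`, `B8Ineq133.cutCfg_mem`.  Kind «kernel-checked proof», theorems only: no
`def`, no `… : Prop` fact, no `instance`, no `notation`, no existing module modified.  `--supports stmt-QuantumFields-20541` (K0⁷-keyed, COUNT-NEUTRAL).

HONEST SCOPE.  Bookkeeping: the group enters through the τ-bodies and the `G`-bridges; NO new estimate; the three REAL families and the (1.59) clause `H59D₁` remain displayed
hypotheses here (discharged downstream exactly as in the unitary record chain); the record crown stays CONDITIONAL on the named Cov facts of `B8Ineq159FlatCovPrintedRec` until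
the referees' identity reads of their proofs (O-Cov-1 ✓p733782, O-Cov-2 ✓p734150 by dag-n05-cov); `HThm4Rec` UNDISCHARGED; N05 ∕ N07 NOT discharged; one finite `𝕋⁴` programme at
fixed `ε`, Bałaban AS PRINTED; nothing continuum ∕ ℝ⁴ ∕ OS ∕ mass-gap ∕ Clay.  No `sorry`, no `def`.
-/

noncomputable section

open NormedSpace
open scoped BigOperators

namespace Literature.MathematicalPhysics.QuantumFieldTheory.Balaban1983to89.B8Prop6DentedCubeMemberFlatScalarGammaGRec

open Complex (I)
open B7Prop1Explicit B7Prop2Explicit B7Prop1Local B7Eq92Concrete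
open B7Prop2Explicit (c2')
open B7Prop2Rec (C0Z AvgClosedZ)
open B7Prop1Explicit (expUnit)
open MatrixLog (mlog)
open B8Prop6OfThm4Rec (localGaugeZ_mem)
open B8Ineq132Rec (pdevOn_lt_of_inAk_box)
open B8Eq131Cubes (tLo_le_tHi)
open B8Eq115GaugeFixing (gaugeAct_mem_of)
open B7Prop4GeneralLevelsRec (cZ gZ KZ gZ_nonneg)
open B7Prop3Flat (c3)
open B7Prop10General (C6)
open B8Ineq132 (covDerivFwd InAk BondTouches)
open B8Ineq133Rec (cutFixedZ)
open B8Eq115GaugeFixingRec (localGaugeZ)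
open B8Eq119TwistedAxialRec (Restr129Z)
open B8Eq184Proof (gaugeExp cfgExp)
open B8Lemma1NonAbelian (mulCfg)
open B8Eq140Level (SideTouches)
open B8Eq146AExpansion (iEta)
open B7SectEFLinearisationRec (linCovIterZ)
open B8Eq155JBound (Jcur wsup)
open B8ScaledSupNorm (bondNorm msup)
open B8Eq138LandauZd (logCfg covLap)
open B8Eq138LandauZdRec (IsLandau138WZ IsLandau138Z QTZ)
open B8Eq1117Concrete (XSpace)
open B8Prop5ContractionKLevel (Bd2)
open B8LambdaSpaceKLevel (wt)
open B8Eq131Cubes (tLo tHi ctr)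
open B8Ineq130Rec (tlo thi)
open B8Eq119TwistedAxialRec (flmZ)
open B8Prop6DentedCubeMemberGammaRec (thm4_hypotheses_one_cutFixed_dented_γ)
open B8Prop6DentedCubeMemberGammaGRec (prop6_exists_dentedMember_at_γ₃_mem)
open B8DentedCubeMemberZdRec (hΩ_sq lamBPT_hbox_pred lamBPT_hclass bdryLayer_dented)
open B8Thm4ExistsAtGammaRec (thm4_windowsZ_γ)
open B9SupplySockB9P3ZdBeta (CrossB)
open B8SockHFPWindowsRec (hfpWindowsZ_of_guard)
open B7ConclGaugeLin (two_le_C6')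
open B8SockHFPTraceFreeRec (sockHFP₀_body_of_join_RD_traceFree sockHFP_body_of_join_59_γ_traceFree)
open B8SockHFPDentedCubeMemberRec (htw_lamST h8lt_lamST h8top_lamST)
open B8Prop5KLevelLettersGRec (hP5base_of_HFP_mem hP5_of_HFP_mem)
open B8Prop5KLevelLettersG (mem_of_mgauge_eq apply_eq_zero_of_cfgExp_mem_of_le_twelfth)
open B8Eq191FlatLettersDirichlet (exists_towerFinset)
open B8Eq191FlatLettersDentedCubeMemberRec (lamST_finite sq_zero_finite sq_subset_zero tower_meets_dented towers_disjoint_dented)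
open Node00 (CubeB8DZ)
open B8Eq191FlatLettersRDTauRec (flatLettersZRD_of_real_tau)
open B8Real123FlatTranslateRec (Real123Block)
open B8Ineq159FlatOfScalarBdryBetaRec (flat159Z_clause_of_scalar_bdryβ)

export B7Prop1Explicit (Site)

variable {d : ℕ}

variable {𝔸 : Type} [CStarAlgebra 𝔸] [Nontrivial 𝔸]

/-! ## Proposition 6 at the dented record member from three real inequality families and the (1.59) clause for `G(1)` — `G`-valued fields and gauge transformations -/

open Classical in
/-- ★★ (RECORD TWIN of `B8Prop6CubeMemberFlatScalarGammaG.prop6_cubeMember_flat_of_real_γ_mem`, at the DENTED record member.) **PROPOSITION 6 (p. 99), EXISTENCE HALF, AT THE DENTED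
RECORD CUBE MEMBER FROM THREE REAL INEQUALITY FAMILIES AND THE (1.59) CLAUSE FOR `G(1)`, EDITION γ, FOR `G`-VALUED FIELDS AND GAUGE TRANSFORMATIONS** —
✓`B8Prop6DentedCubeMemberFlatScalarGammaRec.prop6_dentedMember_flat_of_real_γ` VERBATIM except: the joint J-SU data are parameters (`τ` tracial; `G ≤ H ≤ 𝔸ˣ` with
`AvgClosedZ d L G`, `G ≤ U(𝔸)`, (H2)∕(H3) for `H`, `hexpG`: `e^{iλ} ∈ G` for Hermitian `τ`-free `λ`), `U₀` is `G`-valued, and the conclusion's `u` and `w = v⁻¹u` are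
`G`-valued.  PROOF = the record original's with: (G3) `B8Prop6DentedCubeMemberGammaGRec.prop6_exists_dentedMember_at_γ₃_mem` (dag-n07-w3) as the frame; Proposition 5's base ∕
step bodies served by the record τ-bodies (T4) `B8SockHFPTraceFreeRec.sockHFP₀_body_of_join_RD_traceFree` ∕ `sockHFP_body_of_join_59_γ_traceFree` (conclusion `τ(λ) = 0` ⇒
`e^{iλ} ∈ G` by `hexpG`) through the `G`-bridges (T6) `B8Prop5KLevelLettersGRec.hP5base_of_HFP_mem` ∕ `hP5_of_HFP_mem`; the [4]-letters' `τ`-compatibility from (T7)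
`B8Eq191FlatLettersRDTauRec.flatLettersZRD_of_real_tau`; the cut field ∕ gauge-fixed fields `G`-valued (`B8Ineq133.cutCfg_mem`, `B8Prop6OfThm4Rec.localGaugeZ_mem`,
`B8Prop5KLevelLettersG.mem_of_mgauge_eq`) and the datum exponents `τ`-free by `B8Prop5KLevelLettersG.apply_eq_zero_of_cfgExp_mem_of_le_twelfth` at `η|A| ≤ c⋆ ≤ 1∕12`.
[cite: Balaban1985RegularSpaces, Prop. 6 (1.135)–(1.138) p.99, p.98, Thm 4 p.88, Prop. 5 (1.106)–(1.110) pp.93–94, (1.59) p.86, (1.31) p.82, (1.17) p.78; Balaban1985Averaging, p.20, (42)–(43) pp.23–24; Balaban1985BackgroundPropagators, Thms 3.1–3.3 pp.397–399, (3.23)–(3.25) p.394; Balaban1987RG1, (0.3)–(0.4) pp.252–253] -/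
theorem prop6_dentedMember_flat_of_real_γ_mem (τ : 𝔸 →L[ℂ] ℂ) (hτ : ∀ x y : 𝔸, τ (x * y) = τ (y * x)) (hd2 : 2 ≤ d) {L sL : ℕ} (hLs : L = 2 * sL + 1)
    (hs1 : 1 ≤ sL)
    -- the groups of the joint J-SU: `G` (values of `U₀` AND of the gauge transformations; closed under the record's averaging, unitary, closed under `e^{iλ}` for
    -- Hermitian `τ`-free `λ`) `≤ H` ((H2) `τ(log h) = 0` near `1`, (H3) `e^S ∈ H` for `τ`-free `S`); at `M_N(ℂ)`: `G = SU(N)`, `H = SL(N, ℂ)`, `τ = tr`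
    {G H : Subgroup 𝔸ˣ} (hGrp2 : ∀ g ∈ H, ‖(g : 𝔸) - 1‖ ≤ 1 / 8 → τ (mlog (g : 𝔸)) = 0) (hGrp3 : ∀ S : 𝔸, τ S = 0 → expUnit S ∈ H)
    (hGA : AvgClosedZ d L G) (hGH : G ≤ H) (hGu : G ≤ unitaryUnits 𝔸)
    (hexpG : ∀ lam : Site d → 𝔸, (∀ x, IsSelfAdjoint (lam x)) → (∀ x, τ (lam x) = 0) → ∀ x, gaugeExp lam x ∈ G)
    {B₀ B₀' B₀'H B₂' BG BR : ℝ} (hB₀ : 0 < B₀) (hB₀' : 0 < B₀')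
    (hB : 2 ≤ 5 * (d : ℝ) * L * B₀) (hB₀'H : 0 < B₀'H) (hB₂' : 0 ≤ B₂') (hBG : 0 ≤ BG) (hBR : 0 ≤ BR)
    (hfree : 3 * (2 * (d : ℝ) * (L : ℝ) ^ 2) * BG * BR ≤ B₀') {Bbd : ℝ} (hBbd : 0 ≤ Bbd) (hBd : 4 * Bbd ≤ ((d : ℝ) * L - 1) * B₀) :
    ∃ c₁ : ℝ, 0 < c₁ ∧ ∀ (η : ℝ), 0 < η → ∀ {K : ℕ} {Ω : ℕ → Set (Site d)} (c : CubeB8DZ d L K Ω),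
      ∀ (U₀ : Site d → Fin d → 𝔸ˣ), (∀ x κ, U₀ x κ ∈ G) → ∀ (α₀ : ℝ), 0 < α₀ →
      C0Z d * (α₀ * (L : ℝ) ^ 2) ≤ 1 / 3 → 2 * (α₀ * (L : ℝ) ^ 2) ≤ c2' d L →
      InAk L c.k η α₀ Ω U₀ →
      11 * (d : ℝ) ^ 2 * (L : ℝ) ^ 2 * α₀ + ((c.M : ℝ) + 4 * c.ρ) * d * (L : ℝ) ^ 2 * α₀ ≤ 1 / 6 →
      (L : ℝ) ^ 3 * α₀ + 6 * d * (L : ℝ) ^ 2 * c.M * α₀ ≤ c₁ →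
      -- the weights of `Q′ᵀaQ′` (free, nonnegative) and THE THREE REAL INEQUALITY FAMILIES at every truncation `n ≤ k` on the explicit matrices,
      -- CENTRED labels `flmZ` (g38's `B8Real123FlatTranslateRec.Real123Block`)
      ∀ (w : ℕ → ℝ), (∀ j, 0 ≤ w j) →
      (∀ n, 1 ≤ n → n ≤ c.k → Real123Block L (flmZ L) η n w c.sq (c.lamST n) BG B₀'H B₂' BR) →
      -- (1.59) for `G(1)` IN THE REPAIRED CURRENCY — Theorem 4's two-member clause at background `1` with the support clause and the
      -- exterior-collar allowance (VERBATIM `B8Prop6CubeMemberFlat3Bdry`'s `H59D₁`)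
      ((∀ m, 1 ≤ m → m ≤ c.k → ∀ (u : Site d → 𝔸ˣ) (W : Site d → Fin d → 𝔸ˣ) (A' : Site d → Fin d → 𝔸),
        (∀ x, u x ∈ unitaryUnits 𝔸) → (∀ x, x ∉ c.sq 0 → u x = 1) →
          mgauge (1 : Site d → Fin d → 𝔸ˣ) u W = (cutFixedZ L (tLo c.a c.ρ) (tHi c.a c.M c.ρ) U₀ c.k (ctr c.a c.M)) →
          Restr129Z L m (c.lamST m) (1 : Site d → Fin d → 𝔸ˣ) u →
          IsLandau138WZ L m η (c.sq 0) (c.lamST m) (1 : Site d → Fin d → 𝔸ˣ) W →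
        (∀ y τ, IsSelfAdjoint (A' y τ)) →
        (∀ j, j ≤ m → ∀ y τ, SideTouches (c.sq j) y τ →
        W y τ = cfgExp η A' y τ ∧
          ‖A' y τ‖ ≤ (2 * (L * (5 * (d : ℝ) * L * B₀ * (((L : ℝ) ^ 3 * α₀) + (6 * d * (L : ℝ) ^ 2 * c.M * α₀)))) + 8 * (8 * B₀' * (5 * (d : ℝ) * L * B₀) * (((L : ℝ) ^ 3 * α₀) + (6 * d * (L : ℝ) ^ 2 * c.M * α₀)))) * ((L : ℝ) ^ j * η)⁻¹) →
        (∀ y τ, (∀ j, j ≤ m → ¬ SideTouches (c.sq j) y τ) → A' y τ = 0) →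
        msup L m η (-(1 : ℝ)) (fun j (b : Site d × Fin d) => SideTouches (c.sq j) b.1 b.2) (fun b => A' b.1 b.2)
        ≤ B₀ * (bondNorm L m η (-(3 : ℝ)) c.sq (fun x μ => Jcur η (1 : Site d → Fin d → 𝔸ˣ) A' μ x)
        + wsup 1 (fun p : {p : ℕ × (Site d × Fin d) // p.1 ≤ m ∧ (p.2 ∈ c.lamBPT m p.1 ∨ (p.1 = 0 ∧ CrossB (c.sq 0) p.2))} =>
        linCovIterZ L (1 : Site d → Fin d → 𝔸ˣ) (iEta η A') p.1.1 p.1.2.1 p.1.2.2))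
        + Bbd * msup L m η (-(1 : ℝ)) (fun j (b : Site d × Fin d) => j = 0 ∧ SideTouches (c.sq 0) b.1 b.2 ∧
            ¬ BondTouches (c.sq 0) b.1 b.2) (fun b => A' b.1 b.2) ∧
        msup L m η (-(2 : ℝ)) (fun j (t : Fin d × Fin d × Site d) => SideTouches (c.sq j) t.2.2 t.2.1)
        (fun t => covDerivFwd η (1 : Site d → Fin d → 𝔸ˣ) t.1 (fun z => A' z t.2.1) t.2.2)
        ≤ B₀ * (bondNorm L m η (-(3 : ℝ)) c.sq (fun x μ => Jcur η (1 : Site d → Fin d → 𝔸ˣ) A' μ x)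
        + wsup 1 (fun p : {p : ℕ × (Site d × Fin d) // p.1 ≤ m ∧ (p.2 ∈ c.lamBPT m p.1 ∨ (p.1 = 0 ∧ CrossB (c.sq 0) p.2))} =>
        linCovIterZ L (1 : Site d → Fin d → 𝔸ˣ) (iEta η A') p.1.1 p.1.2.1 p.1.2.2))
        + Bbd * msup L m η (-(1 : ℝ)) (fun j (b : Site d × Fin d) => j = 0 ∧ SideTouches (c.sq 0) b.1 b.2 ∧
            ¬ BondTouches (c.sq 0) b.1 b.2) (fun b => A' b.1 b.2))) →
      ∃ u : Site d → 𝔸ˣ, (∀ x, u x ∈ G) ∧ (∀ x, x ∉ c.sq 0 → u x = 1) ∧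
        Restr129Z L c.k c.lamS (1 : Site d → Fin d → 𝔸ˣ) u ∧
        IsLandau138WZ L c.k η (c.sq 0) c.lamS (1 : Site d → Fin d → 𝔸ˣ)
          (gaugeAct u⁻¹ (cutFixedZ L (tLo c.a c.ρ) (tHi c.a c.M c.ρ) U₀ c.k (ctr c.a c.M))) ∧
        (∀ j, j ≤ c.k → ∀ b ∈ {b : Site d × Fin d | SideTouches (c.sq j) b.1 b.2},
          gaugeAct u⁻¹ (cutFixedZ L (tLo c.a c.ρ) (tHi c.a c.M c.ρ) U₀ c.k (ctr c.a c.M)) b.1 b.2 =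
              cfgExp η (logCfg η (gaugeAct u⁻¹ (cutFixedZ L (tLo c.a c.ρ) (tHi c.a c.M c.ρ) U₀ c.k (ctr c.a c.M)))) b.1 b.2 ∧
            IsSelfAdjoint (logCfg η (gaugeAct u⁻¹ (cutFixedZ L (tLo c.a c.ρ) (tHi c.a c.M c.ρ) U₀ c.k (ctr c.a c.M))) b.1 b.2) ∧
            ‖logCfg η (gaugeAct u⁻¹ (cutFixedZ L (tLo c.a c.ρ) (tHi c.a c.M c.ρ) U₀ c.k (ctr c.a c.M))) b.1 b.2‖ ≤
              (5 * (d : ℝ) * L * B₀ * ((L : ℝ) ^ 3 * α₀ + 6 * d * (L : ℝ) ^ 2 * c.M * α₀)) * ((L : ℝ) ^ j * η)⁻¹) ∧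
        (∀ x, ((localGaugeZ L (tLo c.a c.ρ) (tHi c.a c.M c.ρ) U₀ c.k (ctr c.a c.M))⁻¹ * u) x ∈ G) ∧
        AgreeOn (tlo L (tLo c.a c.ρ) c.k) (thi L (tHi c.a c.M c.ρ) c.k)
          (gaugeAct ((localGaugeZ L (tLo c.a c.ρ) (tHi c.a c.M c.ρ) U₀ c.k (ctr c.a c.M))⁻¹ * u)⁻¹ U₀)
          (gaugeAct u⁻¹ (cutFixedZ L (tLo c.a c.ρ) (tHi c.a c.M c.ρ) U₀ c.k (ctr c.a c.M))) := by
  have hL1 : 1 ≤ L := by omega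
  have hL : 2 ≤ L := by omega
  have hLo : Odd L := ⟨sL, hLs⟩
  have hd1 : 1 ≤ d := le_trans (by norm_num) hd2
  have hd0 : 0 < d := hd1
  have hLr : (1 : ℝ) ≤ L := by exact_mod_cast hL1
  have hdr : (1 : ℝ) ≤ d := by exact_mod_cast hd1
  have hC6 : (2 : ℝ) ≤ C6 d := two_le_C6'
  obtain ⟨c₀, hc₀, P6⟩ := prop6_exists_dentedMember_at_γ₃_mem (𝔸 := 𝔸) hd2 hLs hs1 G hGu hGA hB₀ hB₀' hB hBbd hBd
  obtain ⟨cP, hcP, WIN⟩ := hfpWindowsZ_of_guard hd1 hL1 hB₀ hB₀' hB hB₀'H hB₂' hBG hBR one_pos hfree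
  obtain ⟨c₃, hc₃γ0, WINγ⟩ := thm4_windowsZ_γ hd1 hL1 hB₀ hB₀'
  refine ⟨min (min c₀ cP) c₃, lt_min (lt_min hc₀ hcP) hc₃γ0, ?_⟩
  intro η hη K Ω c U₀ hU₀G α₀ hα hα3 hα2 hA hsmall hc w hw REAL H59
  have hU₀ : ∀ x κ, U₀ x κ ∈ unitaryUnits 𝔸 := fun x κ => hGu (hU₀G x κ)
  simp only [Real123Block] at REAL
  have hk : 1 ≤ c.k := c.one_le_k
  have hρL : L ≤ c.ρ := c.L_le_ρ
  have hρM : c.ρ ≤ c.M := c.ρ_le_M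
  have hc0 : (L : ℝ) ^ 3 * α₀ + 6 * d * (L : ℝ) ^ 2 * c.M * α₀ ≤ c₀ := hc.trans ((min_le_left _ _).trans (min_le_left _ _))
  have hcP' : (L : ℝ) ^ 3 * α₀ + 6 * d * (L : ℝ) ^ 2 * c.M * α₀ ≤ cP := hc.trans ((min_le_left _ _).trans (min_le_right _ _))
  have hc3' : (L : ℝ) ^ 3 * α₀ + 6 * d * (L : ℝ) ^ 2 * c.M * α₀ ≤ c₃ := hc.trans (min_le_right _ _)
  have hρ : 1 ≤ c.ρ := hL1.trans hρL
  have hM1 : 1 ≤ c.M := hρ.trans hρM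
  have hLpos : (0 : ℝ) < L := by positivity
  have hMpos : (0 : ℝ) < c.M := by exact_mod_cast hM1
  have hdpos : (0 : ℝ) < d := by exact_mod_cast hd0
  have hα₀' : 0 < (L : ℝ) ^ 3 * α₀ := by positivity
  have hα₁' : 0 < 6 * (d : ℝ) * (L : ℝ) ^ 2 * c.M * α₀ := by positivity
  -- the pair `(1, U₀″)` at the member
  obtain ⟨hmem, h33, h34, hAx, h135, h66⟩ :=
    thm4_hypotheses_one_cutFixed_dented_γ hLs hs1 hd1 c U₀ hU₀ hα hα3 hα2 hη hA hsmall
  have hone : ∀ x κ, (1 : Site d → Fin d → 𝔸ˣ) x κ ∈ unitaryUnits 𝔸 := fun _ _ => (unitaryUnits 𝔸).one_mem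
  have honeG : ∀ x κ, (1 : Site d → Fin d → 𝔸ˣ) x κ ∈ G := fun _ _ => G.one_mem
  -- the cut gauge-fixed field `U₀″` is `G`-valued (p. 98's local axial gauge of record is `G`-valued for averaging-closed `G`)
  have hΩ' : ∃ l, l ≤ c.k ∧ c.k ≤ l + 1 ∧ ∀ x, InBox (tlo L (tLo c.a c.ρ) c.k) (thi L (tHi c.a c.M c.ρ) c.k) x → x ∈ Ω l :=
    ⟨c.k - 1, Nat.sub_le _ _, by omega, fun x hx => c.tcube_sub hx⟩
  have hvG : ∀ x, localGaugeZ L (tLo c.a c.ρ) (tHi c.a c.M c.ρ) U₀ c.k (ctr c.a c.M) x ∈ G :=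
    localGaugeZ_mem hLs hL (𝔸 := 𝔸) hGA c.k U₀ hU₀G hα hα3 hα2 (tLo_le_tHi hM1) (pdevOn_lt_of_inAk_box hL1 hα hA hΩ') (ctr c.a c.M)
  have hmemG : ∀ x κ, cutFixedZ L (tLo c.a c.ρ) (tHi c.a c.M c.ρ) U₀ c.k (ctr c.a c.M) x κ ∈ G := B8Ineq133.cutCfg_mem (gaugeAct_mem_of hU₀G hvG)
  -- the windows at `(α₀, α₁) := (L³α₀, 6dL²Mα₀)`
  obtain ⟨hside, -, -, hsmall₁, -, -, hα3', hα4', hsmallW, hc₃, hsc, hα₃', hs₁, hs₂, hs₃, hs₄, hs₅, hs₆, hs₇, hsm, hprod8, hcA',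
    ha₁', hb₁', hθ, h103, h106⟩ := WIN _ _ hα₀' hα₁' hcP' _ _ _ _ _ _ _ _ rfl rfl rfl rfl rfl rfl rfl rfl
  -- EDITION γ: [3] Prop. 4's windows one level lower and the (1.61) window with `C₂ := 16·131072(d+1)²·L²`, read at `α₂ := c⋆ ≤ 2(L c⋆) + 8α₄`
  obtain ⟨g5, g6, g9, g10, g13, g14⟩ := WINγ _ _ hα₀' hα₁' hc3' _ _ rfl rfl
  -- smallness read by the plain-currency bridges: `α₄ ≤ 1/84`, `c⋆ ≤ 1/12`, `a ≤ 1/4`, `2a ≤ c⋆`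
  have hsum0 : 0 ≤ (L : ℝ) ^ 3 * α₀ + 6 * d * (L : ℝ) ^ 2 * c.M * α₀ := by positivity
  have hcs0 : 0 ≤ 5 * (d : ℝ) * L * B₀ * ((L : ℝ) ^ 3 * α₀ + 6 * d * (L : ℝ) ^ 2 * c.M * α₀) := by positivity
  have hα₄0 : 0 ≤ 8 * B₀' * (5 * (d : ℝ) * L * B₀) * ((L : ℝ) ^ 3 * α₀ + 6 * d * (L : ℝ) ^ 2 * c.M * α₀) := by positivity
  have hs84 : 8 * B₀' * (5 * (d : ℝ) * L * B₀) * ((L : ℝ) ^ 3 * α₀ + 6 * d * (L : ℝ) ^ 2 * c.M * α₀) ≤ 1 / 84 := by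
    have h := mul_le_mul_of_nonneg_right hC6 (mul_nonneg (by norm_num : (0 : ℝ) ≤ 2) hα₄0)
    nlinarith only [hs₁, h, hα₄0]
  have hcs12 : 5 * (d : ℝ) * L * B₀ * ((L : ℝ) ^ 3 * α₀ + 6 * d * (L : ℝ) ^ 2 * c.M * α₀) ≤ 1 / 12 := by
    have h1 : 5 * (d : ℝ) * L * B₀ * ((L : ℝ) ^ 3 * α₀ + 6 * d * (L : ℝ) ^ 2 * c.M * α₀) ≤
        L * (5 * (d : ℝ) * L * B₀ * ((L : ℝ) ^ 3 * α₀ + 6 * d * (L : ℝ) ^ 2 * c.M * α₀)) := le_mul_of_one_le_left hcs0 hLr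
    have h2 : L * (5 * (d : ℝ) * L * B₀ * ((L : ℝ) ^ 3 * α₀ + 6 * d * (L : ℝ) ^ 2 * c.M * α₀)) ≤
        d * (L * (5 * (d : ℝ) * L * B₀ * ((L : ℝ) ^ 3 * α₀ + 6 * d * (L : ℝ) ^ 2 * c.M * α₀))) :=
      le_mul_of_one_le_left (mul_nonneg hLpos.le hcs0) hdr
    have hK2 : (2 : ℝ) ≤ KZ d L := by have h := gZ_nonneg d L; show (2 : ℝ) ≤ 2 * (1 + 2 * gZ d L); linarith only [h]
    have h3 : (d : ℝ) * (L * (5 * (d : ℝ) * L * B₀ * ((L : ℝ) ^ 3 * α₀ + 6 * d * (L : ℝ) ^ 2 * c.M * α₀))) * 2 ≤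
        (d : ℝ) * (L * (5 * (d : ℝ) * L * B₀ * ((L : ℝ) ^ 3 * α₀ + 6 * d * (L : ℝ) ^ 2 * c.M * α₀))) * KZ d L :=
      mul_le_mul_of_nonneg_left hK2 (by positivity)
    linarith only [h1, h2, h3, hsc]
  have ha : 6 * (d : ℝ) * (L : ℝ) ^ 2 * c.M * α₀ ≤ 1 / 4 := by
    have h1 : 6 * (d : ℝ) * (L : ℝ) ^ 2 * c.M * α₀ ≤ (d : ℝ) * L * (6 * (d : ℝ) * (L : ℝ) ^ 2 * c.M * α₀) := by
      have hdL : (1 : ℝ) ≤ (d : ℝ) * L := one_le_mul_of_one_le_of_one_le hdr hLr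
      exact le_mul_of_one_le_left hα₁'.le hdL
    linarith only [h1, hsmall₁]
  have ha2 : 2 * (6 * (d : ℝ) * (L : ℝ) ^ 2 * c.M * α₀) ≤ 5 * (d : ℝ) * L * B₀ * ((L : ℝ) ^ 3 * α₀ + 6 * d * (L : ℝ) ^ 2 * c.M * α₀) := by
    have h1 : 2 * (6 * (d : ℝ) * (L : ℝ) ^ 2 * c.M * α₀) ≤ 2 * ((L : ℝ) ^ 3 * α₀ + 6 * d * (L : ℝ) ^ 2 * c.M * α₀) := by linarith only [hα₀']
    exact h1.trans (mul_le_mul_of_nonneg_right hB hsum0)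
  -- the γ windows at `α₂ := c⋆` (monotone in `c⋆ ≤ 2(L c⋆) + 8α₄`)
  have hcsw : 5 * (d : ℝ) * L * B₀ * ((L : ℝ) ^ 3 * α₀ + 6 * d * (L : ℝ) ^ 2 * c.M * α₀) ≤
      2 * (L * (5 * (d : ℝ) * L * B₀ * ((L : ℝ) ^ 3 * α₀ + 6 * d * (L : ℝ) ^ 2 * c.M * α₀)))
        + 8 * (8 * B₀' * (5 * (d : ℝ) * L * B₀) * ((L : ℝ) ^ 3 * α₀ + 6 * d * (L : ℝ) ^ 2 * c.M * α₀)) := by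
    have h1 : 5 * (d : ℝ) * L * B₀ * ((L : ℝ) ^ 3 * α₀ + 6 * d * (L : ℝ) ^ 2 * c.M * α₀) ≤
        L * (5 * (d : ℝ) * L * B₀ * ((L : ℝ) ^ 3 * α₀ + 6 * d * (L : ℝ) ^ 2 * c.M * α₀)) := le_mul_of_one_le_left hcs0 hLr
    linarith only [h1, hcs0, hα₄0]
  have hLcsw := mul_le_mul_of_nonneg_left hcsw hLpos.le
  have h16γ : 16 * ((L : ℝ) * (5 * (d : ℝ) * L * B₀ * ((L : ℝ) ^ 3 * α₀ + 6 * d * (L : ℝ) ^ 2 * c.M * α₀))) ≤ 1 := by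
    have hK2 : (2 : ℝ) ≤ KZ d L := by have h := gZ_nonneg d L; show (2 : ℝ) ≤ 2 * (1 + 2 * gZ d L); linarith only [h]
    have h0 : 0 ≤ (L : ℝ) * (5 * (d : ℝ) * L * B₀ * ((L : ℝ) ^ 3 * α₀ + 6 * d * (L : ℝ) ^ 2 * c.M * α₀)) := by positivity
    have h1 : (L : ℝ) * (5 * (d : ℝ) * L * B₀ * ((L : ℝ) ^ 3 * α₀ + 6 * d * (L : ℝ) ^ 2 * c.M * α₀)) * 2 ≤
        (L : ℝ) * (5 * (d : ℝ) * L * B₀ * ((L : ℝ) ^ 3 * α₀ + 6 * d * (L : ℝ) ^ 2 * c.M * α₀)) * KZ d L := mul_le_mul_of_nonneg_left hK2 h0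
    have h2 : (L : ℝ) * (5 * (d : ℝ) * L * B₀ * ((L : ℝ) ^ 3 * α₀ + 6 * d * (L : ℝ) ^ 2 * c.M * α₀)) * KZ d L ≤
        (d : ℝ) * ((L : ℝ) * (5 * (d : ℝ) * L * B₀ * ((L : ℝ) ^ 3 * α₀ + 6 * d * (L : ℝ) ^ 2 * c.M * α₀)) * KZ d L) :=
      le_mul_of_one_le_left (by positivity) hdr
    linarith only [hsc, h1, h2]
  have hKZ0 : 0 ≤ KZ d L := by unfold KZ; have := gZ_nonneg d L; positivity
  have hgZ := gZ_nonneg d L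
  have hsmallγ : Real.exp (4 * cZ d * ((L : ℝ) ^ 2 * ((L : ℝ) ^ 3 * α₀)))
      * (1 + 2 * (131072 * ((d : ℝ) + 1) ^ 2) * (KZ d L) ^ 2 * ((L : ℝ) * (5 * (d : ℝ) * L * B₀ * ((L : ℝ) ^ 3 * α₀ + 6 * d * (L : ℝ) ^ 2 * c.M * α₀)))) ≤ 2 := by
    refine le_trans (mul_le_mul_of_nonneg_left ?_ (Real.exp_pos _).le) g9
    have h := mul_le_mul_of_nonneg_left hLcsw (show (0 : ℝ) ≤ 2 * (131072 * ((d : ℝ) + 1) ^ 2) * (KZ d L) ^ 2 by positivity)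
    linarith only [h]
  have hc₃γ : KZ d L * ((L : ℝ) * (5 * (d : ℝ) * L * B₀ * ((L : ℝ) ^ 3 * α₀ + 6 * d * (L : ℝ) ^ 2 * c.M * α₀))) ≤ c3 d L :=
    (mul_le_mul_of_nonneg_left hLcsw hKZ0).trans g10
  have h61γ : 2 * (5 * (d : ℝ) * L * B₀ * ((L : ℝ) ^ 3 * α₀ + 6 * d * (L : ℝ) ^ 2 * c.M * α₀)) ^ 2
      + 20 * d * ((L : ℝ) ^ 3 * α₀) * (5 * (d : ℝ) * L * B₀ * ((L : ℝ) ^ 3 * α₀ + 6 * d * (L : ℝ) ^ 2 * c.M * α₀))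
      + 2 * (2 * ((1 + 2 * gZ d L) * (2 * (131072 * ((d : ℝ) + 1) ^ 2) * (KZ d L) ^ 2)) * (L : ℝ) ^ 2) * (5 * (d : ℝ) * L * B₀ * ((L : ℝ) ^ 3 * α₀ + 6 * d * (L : ℝ) ^ 2 * c.M * α₀)) ^ 2
      ≤ (L : ℝ) ^ 3 * α₀ + 6 * d * (L : ℝ) ^ 2 * c.M * α₀ := by
    have hsq : (5 * (d : ℝ) * L * B₀ * ((L : ℝ) ^ 3 * α₀ + 6 * d * (L : ℝ) ^ 2 * c.M * α₀)) ^ 2 ≤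
        (2 * (L * (5 * (d : ℝ) * L * B₀ * ((L : ℝ) ^ 3 * α₀ + 6 * d * (L : ℝ) ^ 2 * c.M * α₀)))
          + 8 * (8 * B₀' * (5 * (d : ℝ) * L * B₀) * ((L : ℝ) ^ 3 * α₀ + 6 * d * (L : ℝ) ^ 2 * c.M * α₀))) ^ 2 :=
      pow_le_pow_left₀ hcs0 hcsw 2
    have hlin : 20 * d * ((L : ℝ) ^ 3 * α₀) * (5 * (d : ℝ) * L * B₀ * ((L : ℝ) ^ 3 * α₀ + 6 * d * (L : ℝ) ^ 2 * c.M * α₀)) ≤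
        20 * d * ((L : ℝ) ^ 3 * α₀) * (2 * (L * (5 * (d : ℝ) * L * B₀ * ((L : ℝ) ^ 3 * α₀ + 6 * d * (L : ℝ) ^ 2 * c.M * α₀)))
          + 8 * (8 * B₀' * (5 * (d : ℝ) * L * B₀) * ((L : ℝ) ^ 3 * α₀ + 6 * d * (L : ℝ) ^ 2 * c.M * α₀))) :=
      mul_le_mul_of_nonneg_left hcsw (by positivity)
    have hK0 : (0 : ℝ) ≤ 2 * (2 * ((1 + 2 * gZ d L) * (2 * (131072 * ((d : ℝ) + 1) ^ 2) * (KZ d L) ^ 2)) * (L : ℝ) ^ 2) := by positivity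
    have hsq' := mul_le_mul_of_nonneg_left hsq hK0
    linarith only [g14, hsq, hlin, hsq']
  -- the exponent of a small `G`-valued datum is `τ`-free ((H2) at Theorem 4's window `η|A| ≤ c⋆ ≤ 1∕12`)
  have hAτ_of : ∀ {W : Site d → Fin d → 𝔸ˣ}, (∀ x κ, W x κ ∈ G) → ∀ {A : Site d → Fin d → 𝔸} {n : ℕ},
      (∀ j, j ≤ n → ∀ b ∈ {b : Site d × Fin d | SideTouches (c.sq j) b.1 b.2},
        W b.1 b.2 = cfgExp η A b.1 b.2 ∧ IsSelfAdjoint (A b.1 b.2) ∧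
          ‖A b.1 b.2‖ ≤ (5 * (d : ℝ) * L * B₀ * ((L : ℝ) ^ 3 * α₀ + 6 * d * (L : ℝ) ^ 2 * c.M * α₀)) * ((L : ℝ) ^ j * η)⁻¹) →
      ∀ j, j ≤ n → ∀ b ∈ {b : Site d × Fin d | SideTouches (c.sq j) b.1 b.2}, τ (A b.1 b.2) = 0 := by
    intro W hWG A n hdatW j hj b hb
    obtain ⟨hexp, -, hbd⟩ := hdatW j hj b hb
    refine apply_eq_zero_of_cfgExp_mem_of_le_twelfth τ hGH hGrp2 hη (hexp ▸ hWG b.1 b.2) ?_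
    have hLj : (1 : ℝ) ≤ (L : ℝ) ^ j := one_le_pow₀ hLr
    have hinv : ((L : ℝ) ^ j * η)⁻¹ ≤ η⁻¹ := by
      rw [mul_inv]
      calc ((L : ℝ) ^ j)⁻¹ * η⁻¹ ≤ 1 * η⁻¹ := by gcongr; exact inv_le_one_of_one_le₀ hLj
        _ = η⁻¹ := one_mul _
    calc η * ‖A b.1 b.2‖ ≤ η * ((5 * (d : ℝ) * L * B₀ * ((L : ℝ) ^ 3 * α₀ + 6 * d * (L : ℝ) ^ 2 * c.M * α₀)) * η⁻¹) :=
          mul_le_mul_of_nonneg_left (hbd.trans (mul_le_mul_of_nonneg_left hinv hcs0)) hη.le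
      _ = 5 * (d : ℝ) * L * B₀ * ((L : ℝ) ^ 3 * α₀ + 6 * d * (L : ℝ) ^ 2 * c.M * α₀) := by field_simp
      _ ≤ 1 / 12 := hcs12
  -- the member's geometry (edition γ: the split print class `cubeLamBP'`, box law «box ⊂ □_{j−1}», inner ∕ crossing ∕ mirrored trichotomy)
  have hΩc := hΩ_sq c hLo
  have hboxc := lamBPT_hbox_pred c hLs
  have hclassc := lamBPT_hclass c hLs
  have htw := htw_lamST c hLo
  have h8lt := h8lt_lamST c hLo
  have h8top := h8top_lamST c hLo
  refine P6 η hη c U₀ hU₀G α₀ hα hα3 hα2 hA hsmall hc0 ?_ ?_ H59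
  · -- `P5base₁`: the base body at `U₀ = 1` + the plain-currency bridge
    refine hP5base_of_HFP_mem hd2 hη L hone hmem hs84 hcs12 ha ha2 c.sq c.lamST h66
      fun A hdat => ?_
    classical
    obtain ⟨S, hS⟩ : ∃ S : Finset (Site d), ∀ x, x ∈ S ↔ x ∈ c.sq 0 :=
      ⟨(sq_zero_finite c hLo).toFinset, fun x => Set.Finite.mem_toFinset _⟩
    obtain ⟨B, hB'⟩ := exists_towerFinset 1 (c.lamST 1) (fun j _ => lamST_finite c hLo 1 j)
    obtain ⟨rG, rH, rR⟩ := REAL 1 le_rfl hk S hS B hB' _ (fun _ _ => rfl) _ rfl _ rfl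
    obtain ⟨g, Δ, q, qs, Aw, cL, H', g_rightΩ, c_range, hΔ, hqs, hq, hH0, hH1, hH2, hHsupp, hHequiv, hQH, hG, hGsupp, hGreal, hRbd,
      hRreal, hHτ, hGτ, hRτ⟩ := flatLettersZRD_of_real_tau (𝔸 := 𝔸) τ hd0 hη hLo 1 c.sq
        (fun j _ => sq_subset_zero c hLo j) (c.lamST 1) w hw S hS (tower_meets_dented c hLo hk)
        (towers_disjoint_dented c hLo hk) B hB' _ (fun _ _ => rfl) _ rfl _ rfl rG rH rR
    obtain ⟨lam, hlsa, hloff, hlτ, h108, hmul, h129'⟩ := sockHFP₀_body_of_join_RD_traceFree τ hτ hd2 hLs hs1 hη hk hGrp2 hGrp3 hGA hGH hGu hΩc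
      (htw 1 hk) hα₀' hα₁' hB₀ hB₀' rfl rfl honeG h33 h34 hAx hdat (hAτ_of hmemG hdat) g Δ q qs Aw cL g_rightΩ
      c_range hΔ hqs hq H' hB₀'H hB₂' hBG hBR hH0 hH1 hH2 hHsupp hHequiv hQH hG hGsupp hGreal hRbd hRreal hHτ hGτ hRτ le_rfl le_rfl le_rfl hα3'
      hα4' hsmallW hc₃ hsc hα₃' hs₁ hs₂ hs₃ hs₄ hs₅ hs₆ hs₇ hsm hprod8 rfl rfl rfl rfl hcA' ha₁' hb₁' hθ h103 h106
    exact ⟨lam, hlsa, hloff, hexpG lam hlsa hlτ, h108, hmul, h129'⟩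
  · -- `P5step₁`: the step body at `U₀ = 1` with its (1.59) clause read off `H59₁` + the plain-currency bridge
    refine hP5_of_HFP_mem hd2 hη L c.k hone hs84 hcs12 c.sq c.lamST
      fun m hm1 hmk u₁ U₁ A hu₁G hu₁S hW h129 hLan hdat => ?_
    have hu₁ : ∀ x, u₁ x ∈ unitaryUnits 𝔸 := fun x => hGu (hu₁G x)
    have hU₁G : ∀ x κ, U₁ x κ ∈ G := mem_of_mgauge_eq honeG hmemG hu₁G hW
    classical
    obtain ⟨S, hS⟩ : ∃ S : Finset (Site d), ∀ x, x ∈ S ↔ x ∈ c.sq 0 :=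
      ⟨(sq_zero_finite c hLo).toFinset, fun x => Set.Finite.mem_toFinset _⟩
    obtain ⟨B, hB'⟩ := exists_towerFinset (m + 1) (c.lamST (m + 1)) (fun j _ => lamST_finite c hLo (m + 1) j)
    obtain ⟨rG, rH, rR⟩ := REAL (m + 1) (by omega) hmk S hS B hB' _ (fun _ _ => rfl) _ rfl _ rfl
    obtain ⟨g, Δ, q, qs, Aw, cL, H', g_rightΩ, c_range, hΔ, hqs, hq, hH0, hH1, hH2, hHsupp, hHequiv, hQH, hG, hGsupp, hGreal, hRbd,
      hRreal, hHτ, hGτ, hRτ⟩ := flatLettersZRD_of_real_tau (𝔸 := 𝔸) τ hd0 hη hLo (m + 1) c.sq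
        (fun j _ => sq_subset_zero c hLo j) (c.lamST (m + 1)) w hw S hS (tower_meets_dented c hLo hmk)
        (towers_disjoint_dented c hLo hmk) B hB' _ (fun _ _ => rfl) _ rfl _ rfl rG rH rR
    have hcDAlo : (d : ℝ) * (L : ℝ) ^ 2 * (5 * (d : ℝ) * L * B₀ * ((L : ℝ) ^ 3 * α₀ + 6 * d * (L : ℝ) ^ 2 * c.M * α₀)) ≤
        2 * (d : ℝ) * (L : ℝ) ^ 2 * (5 * (d : ℝ) * L * B₀ * ((L : ℝ) ^ 3 * α₀ + 6 * d * (L : ℝ) ^ 2 * c.M * α₀)) := by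
      have h := mul_nonneg (by positivity : (0 : ℝ) ≤ (d : ℝ) * (L : ℝ) ^ 2) hcs0
      linarith only [h]
    -- Theorem 4's two-member (1.59) clause WITH THE EXTERIOR-COLLAR ALLOWANCE for this datum, from `H59D₁` (allowance `c⋆ ≤ 2Lc⋆ + 8α₄`)
    have H59Dβm : ∀ A' : Site d → Fin d → 𝔸, (∀ y τ, IsSelfAdjoint (A' y τ)) →
        (∀ j, j ≤ m → ∀ (y : Site d) (τ : Fin d), SideTouches (c.sq j) y τ →
          U₁ y τ = cfgExp η A' y τ ∧
            ‖A' y τ‖ ≤ (5 * (d : ℝ) * L * B₀ * ((L : ℝ) ^ 3 * α₀ + 6 * d * (L : ℝ) ^ 2 * c.M * α₀)) * ((L : ℝ) ^ j * η)⁻¹) →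
        (∀ (y : Site d) (τ : Fin d), (∀ j, j ≤ m → ¬ SideTouches (c.sq j) y τ) → A' y τ = 0) →
        msup L m η (-(1 : ℝ)) (fun j (b : Site d × Fin d) => SideTouches (c.sq j) b.1 b.2) (fun b => A' b.1 b.2)
            ≤ B₀ * (bondNorm L m η (-(3 : ℝ)) c.sq (fun x μ => Jcur η (1 : Site d → Fin d → 𝔸ˣ) A' μ x)
              + wsup 1 (fun p : {p : ℕ × (Site d × Fin d) // p.1 ≤ m ∧ (p.2 ∈ c.lamBPT m p.1 ∨ (p.1 = 0 ∧ CrossB (c.sq 0) p.2))} =>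
                  linCovIterZ L (1 : Site d → Fin d → 𝔸ˣ) (iEta η A') p.1.1 p.1.2.1 p.1.2.2))
              + Bbd * msup L m η (-(1 : ℝ)) (fun j (b : Site d × Fin d) => j = 0 ∧ SideTouches (c.sq 0) b.1 b.2 ∧
                  ¬ BondTouches (c.sq 0) b.1 b.2) (fun b => A' b.1 b.2) ∧
          msup L m η (-(2 : ℝ)) (fun j (t : Fin d × Fin d × Site d) => SideTouches (c.sq j) t.2.2 t.2.1)
              (fun t => covDerivFwd η (1 : Site d → Fin d → 𝔸ˣ) t.1 (fun z => A' z t.2.1) t.2.2)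
            ≤ B₀ * (bondNorm L m η (-(3 : ℝ)) c.sq (fun x μ => Jcur η (1 : Site d → Fin d → 𝔸ˣ) A' μ x)
              + wsup 1 (fun p : {p : ℕ × (Site d × Fin d) // p.1 ≤ m ∧ (p.2 ∈ c.lamBPT m p.1 ∨ (p.1 = 0 ∧ CrossB (c.sq 0) p.2))} =>
                  linCovIterZ L (1 : Site d → Fin d → 𝔸ˣ) (iEta η A') p.1.1 p.1.2.1 p.1.2.2))
              + Bbd * msup L m η (-(1 : ℝ)) (fun j (b : Site d × Fin d) => j = 0 ∧ SideTouches (c.sq 0) b.1 b.2 ∧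
                  ¬ BondTouches (c.sq 0) b.1 b.2) (fun b => A' b.1 b.2) := by
      intro A' hsa hWA hA0
      refine H59 m hm1 hmk.le u₁ U₁ A' hu₁ hu₁S hW h129 hLan hsa (fun j hj y τ hs => ⟨(hWA j hj y τ hs).1, (hWA j hj y τ hs).2.trans ?_⟩)
        hA0
      have hw0 : 0 ≤ ((L : ℝ) ^ j * η)⁻¹ := by positivity
      refine mul_le_mul_of_nonneg_right ?_ hw0
      have h1 : 5 * (d : ℝ) * L * B₀ * ((L : ℝ) ^ 3 * α₀ + 6 * d * (L : ℝ) ^ 2 * c.M * α₀) ≤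
          L * (5 * (d : ℝ) * L * B₀ * ((L : ℝ) ^ 3 * α₀ + 6 * d * (L : ℝ) ^ 2 * c.M * α₀)) := le_mul_of_one_le_left hcs0 hLr
      linarith only [h1, hcs0, hα₄0]
    obtain ⟨lam, hlsa, hloff, hlτ, h108, hmul, h129'⟩ := sockHFP_body_of_join_59_γ_traceFree τ hτ hd2 hLs hs1 hη hGrp2 hGrp3 hGA hGH hGu hΩc hboxc
      hclassc hm1 hmk (htw (m + 1) hmk) (h8lt m hmk) (h8top m hmk) hα₀' hα₁' hB₀
      hB₀' rfl rfl honeG hmem h33 h34 hAx h135 h66 (bdryLayer_dented c hLs hs1) hBbd hBd hu₁ (fun x => hGH (hu₁G x)) hu₁S hW h129 hLan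
      hdat (hAτ_of hU₁G hdat) H59Dβm hside g13 h61γ hsmall₁ g5 g6 h16γ hsmallγ hc₃γ
      g Δ q qs Aw cL g_rightΩ c_range hΔ hqs hq
      H' hB₀'H hB₂' hBG hBR hH0 hH1 hH2 hHsupp hHequiv hQH hG hGsupp hGreal hRbd hRreal hHτ hGτ hRτ le_rfl le_rfl hcDAlo hα3' hα4' hsmallW hc₃
      hsc hα₃' hs₁ hs₂ hs₃ hs₄ hs₅ hs₆ hs₇ hsm hprod8 rfl rfl rfl rfl hcA' ha₁' hb₁' hθ h103 h106
    exact ⟨lam, hlsa, hloff, hexpG lam hlsa hlτ, h108, hmul, h129'⟩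

#print axioms prop6_dentedMember_flat_of_real_γ_mem

end Literature.MathematicalPhysics.QuantumFieldTheory.Balaban1983to89.B8Prop6DentedCubeMemberFlatScalarGammaGRec

end
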